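import Summits.KontsevichZagierPeriods.KontsevichZagierPeriods.Theses.IsogenyCertificates
import Literature.NumberTheory.EllipticCurves.XMapCertificate

/-!
# `XMapPeriodTransfer`: the datum side — what the two datum conjuncts carry, and what they do not

Negative knowledge for the crux `IsogenyCertificates.XMapPeriodTransfer`
(stmt-KontsevichZagierPeriods-10665; refuter, cdisprove). The x-rational isogeny datum `(f, g, c)`
enters the crux ONLY EXISTENTIALLY (`iff_exists_datum`), and that existential is the tree predicate
`Literature.NumberTheory.EllipticCurves.HasXMapCertificate` up to the forced conjuncts `g ≠ 0`,
`c ≠ 0` (`exists_datum_iff_hasXMapCertificate`, `iff_certificate`). Dropping EITHER conjunct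
(`W ≠ 0`, or the identity `c²g(f³+A′fg²+B′g³) = P·W²`) collapses the crux onto the route's crux #4
`RealPeriodSectorComplete` (no isogeny hypothesis at all; transcendence strength):
`withoutWronskian_iff_sectorComplete`, `withoutIdentity_iff_sectorComplete` — both conjuncts are
load-bearing for the proof plan, while no `¬`-theorem can exist on this side (the collapsed
statement is conjecturally true). The planner's fallback restatement "require gcd(f,g) = 1" (route
KILL CRITERIA) is EQUIVALENT to the crux (`iff_coprime`), not a repair. The degenerate data recorded
at the end (`[−1]`, scalings, the lemniscate 2-isogeny and its dual, whose real image misses the egg: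
`m₁ = 0`) are all in scope and all genuine real coverings. Everything is stated inline (no new
definitions). Companion work file: `Cruxes/XMapPeriodTransfer/Disproof.lean`.
-/

noncomputable section

namespace Summit.KontsevichZagierPeriods.IsogenyCertificates.XMapPeriodTransferDatum

open Polynomial Set MeasureTheory
open Literature.NumberTheory.Transcendental
open Literature.NumberTheory.EllipticCurves (HasXMapCertificate)
open Summit.KontsevichZagierPeriods.KontsevichZagierPeriods.Theses.IsogenyCertificates

/-- **The datum is used only existentially.** [folklore] -/
theorem iff_exists_datum :
    XMapPeriodTransfer ↔ ∀ A B A' B' : ℤ, 4 * A ^ 3 + 27 * B ^ 2 ≠ 0 → 4 * A' ^ 3 + 27 * B' ^ 2 ≠ 0 →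
      (∃ (f g : ℚ[X]) (c : ℚ), derivative f * g - f * derivative g ≠ 0 ∧
        C (c ^ 2) * g * (f ^ 3 + C (A' : ℚ) * f * g ^ 2 + C (B' : ℚ) * g ^ 3) =
        (X ^ 3 + C (A : ℚ) * X + C (B : ℚ)) * (derivative f * g - f * derivative g) ^ 2) →
      ∀ (a b : ℚ), 0 < a → 0 < b → ∀ (r r' : KZ.IntegralRep 1),
        r.domain = {x | 0 < x 0 ^ 3 + (A : ℝ) * x 0 + (B : ℝ)} →
        EqOn r.integrand (fun x => (a : ℝ) / Real.sqrt (x 0 ^ 3 + (A : ℝ) * x 0 + (B : ℝ))) r.domain →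
        r'.domain = {x | 0 < x 0 ^ 3 + (A' : ℝ) * x 0 + (B' : ℝ)} →
        EqOn r'.integrand (fun x => (b : ℝ) / Real.sqrt (x 0 ^ 3 + (A' : ℝ) * x 0 + (B' : ℝ))) r'.domain →
        r.value = r'.value → KZ.Equivalent r r' := by
  constructor
  · rintro h A B A' B' hΔ hΔ' ⟨f, g, c, hW, hI⟩ a b ha hb r r' h1 h2 h3 h4 h5
    exact h A B A' B' hΔ hΔ' f g c hW hI a b ha hb r r' h1 h2 h3 h4 h5
  · intro h A B A' B' hΔ hΔ' f g c hW hI a b ha hb r r' h1 h2 h3 h4 h5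
    exact h A B A' B' hΔ hΔ' ⟨f, g, c, hW, hI⟩ a b ha hb r r' h1 h2 h3 h4 h5

/-- The Weierstrass cubic `X³ + AX + B` is never the zero polynomial (it is monic). [folklore] -/
theorem cubic_ne_zero (A B : ℤ) : (X ^ 3 + C (A : ℚ) * X + C (B : ℚ) : ℚ[X]) ≠ 0 := by
  have hm : (X ^ 3 + (C (A : ℚ) * X + C (B : ℚ)) : ℚ[X]).Monic :=
    monic_X_pow_add (degree_linear_le.trans_lt (by norm_num))
  rw [← add_assoc] at hm
  exact hm.ne_zero

/-- **Forced non-degeneracy**: a datum has `g ≠ 0` and `c ≠ 0` (so the typed shape admits no junk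
datum: `g = 0` kills `W`, `c = 0` gives `P·W² = 0` in the domain `ℚ[X]`). [folklore] -/
theorem g_ne_zero_and_c_ne_zero {A B A' B' : ℤ} {f g : ℚ[X]} {c : ℚ} (hW : derivative f * g - f * derivative g ≠ 0)
    (hI : C (c ^ 2) * g * (f ^ 3 + C (A' : ℚ) * f * g ^ 2 + C (B' : ℚ) * g ^ 3) =
        (X ^ 3 + C (A : ℚ) * X + C (B : ℚ)) * (derivative f * g - f * derivative g) ^ 2) :
    g ≠ 0 ∧ c ≠ 0 := by
  refine ⟨?_, ?_⟩
  · rintro rfl; exact hW (by simp)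
  · rintro rfl
    simp only [ne_eq, OfNat.ofNat_ne_zero, not_false_eq_true, zero_pow, map_zero, zero_mul] at hI
    exact (mul_ne_zero (cubic_ne_zero A B) (pow_ne_zero 2 hW)) hI.symm

/-- **Bridge to the tree predicate** `HasXMapCertificate` (XMapCertificate.lean; Washington 2008,
§2.9, Remark 2.26). [cite: Washington2008, §2.9] -/
theorem exists_datum_iff_hasXMapCertificate (A B A' B' : ℤ) :
    (∃ (f g : ℚ[X]) (c : ℚ), derivative f * g - f * derivative g ≠ 0 ∧
        C (c ^ 2) * g * (f ^ 3 + C (A' : ℚ) * f * g ^ 2 + C (B' : ℚ) * g ^ 3) =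
        (X ^ 3 + C (A : ℚ) * X + C (B : ℚ)) * (derivative f * g - f * derivative g) ^ 2) ↔
      HasXMapCertificate (A : ℚ) (B : ℚ) (A' : ℚ) (B' : ℚ) := by
  constructor
  · rintro ⟨f, g, c, hW, hI⟩
    have h := g_ne_zero_and_c_ne_zero hW hI
    exact ⟨f, g, c, h.1, h.2, hW, hI.symm⟩
  · rintro ⟨f, g, u, -, -, hW, hI⟩
    exact ⟨f, g, u, hW, hI.symm⟩

/-- **The crux over the tree predicate.** [cite: Washington2008, §2.9] -/
theorem iff_certificate :
    XMapPeriodTransfer ↔ ∀ A B A' B' : ℤ, 4 * A ^ 3 + 27 * B ^ 2 ≠ 0 → 4 * A' ^ 3 + 27 * B' ^ 2 ≠ 0 →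
      HasXMapCertificate (A : ℚ) (B : ℚ) (A' : ℚ) (B' : ℚ) →
      ∀ (a b : ℚ), 0 < a → 0 < b → ∀ (r r' : KZ.IntegralRep 1),
        r.domain = {x | 0 < x 0 ^ 3 + (A : ℝ) * x 0 + (B : ℝ)} →
        EqOn r.integrand (fun x => (a : ℝ) / Real.sqrt (x 0 ^ 3 + (A : ℝ) * x 0 + (B : ℝ))) r.domain →
        r'.domain = {x | 0 < x 0 ^ 3 + (A' : ℝ) * x 0 + (B' : ℝ)} →
        EqOn r'.integrand (fun x => (b : ℝ) / Real.sqrt (x 0 ^ 3 + (A' : ℝ) * x 0 + (B' : ℝ))) r'.domain →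
        r.value = r'.value → KZ.Equivalent r r' := by
  rw [iff_exists_datum]
  refine forall₄_congr fun A B A' B' => ?_
  rw [exists_datum_iff_hasXMapCertificate]

/-- **WLOG `f, g` coprime** (`HasXMapCertificate.exists_isCoprime`): requiring `IsCoprime f g` in
the datum does not weaken the crux. [folklore] -/
theorem iff_coprime :
    XMapPeriodTransfer ↔ ∀ A B A' B' : ℤ, 4 * A ^ 3 + 27 * B ^ 2 ≠ 0 → 4 * A' ^ 3 + 27 * B' ^ 2 ≠ 0 →
      (∃ (f g : ℚ[X]) (c : ℚ), IsCoprime f g ∧ derivative f * g - f * derivative g ≠ 0 ∧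
        C (c ^ 2) * g * (f ^ 3 + C (A' : ℚ) * f * g ^ 2 + C (B' : ℚ) * g ^ 3) =
        (X ^ 3 + C (A : ℚ) * X + C (B : ℚ)) * (derivative f * g - f * derivative g) ^ 2) →
      ∀ (a b : ℚ), 0 < a → 0 < b → ∀ (r r' : KZ.IntegralRep 1),
        r.domain = {x | 0 < x 0 ^ 3 + (A : ℝ) * x 0 + (B : ℝ)} →
        EqOn r.integrand (fun x => (a : ℝ) / Real.sqrt (x 0 ^ 3 + (A : ℝ) * x 0 + (B : ℝ))) r.domain →
        r'.domain = {x | 0 < x 0 ^ 3 + (A' : ℝ) * x 0 + (B' : ℝ)} →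
        EqOn r'.integrand (fun x => (b : ℝ) / Real.sqrt (x 0 ^ 3 + (A' : ℝ) * x 0 + (B' : ℝ))) r'.domain →
        r.value = r'.value → KZ.Equivalent r r' := by
  rw [iff_certificate]
  refine forall₄_congr fun A B A' B' => forall₂_congr fun _ _ => ?_
  refine Iff.intro (fun h ⟨f, g, c, _, hW, hI⟩ => ?_) (fun h hc => ?_)
  · have h' := g_ne_zero_and_c_ne_zero hW hI
    exact h ⟨f, g, c, h'.1, h'.2, hW, hI.symm⟩
  · obtain ⟨f, g, u, hcop, -, -, hW, hI⟩ := hc.exists_isCoprime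
    exact h ⟨f, g, u, hcop, hW, hI.symm⟩

/-- **`W ≠ 0` is load-bearing for the proof plan, not refutable**: with it deleted, the identity is
solved by `g = 0` for every pair of curves, and the crux becomes crux #4 verbatim. [folklore] -/
theorem withoutWronskian_iff_sectorComplete :
    (∀ A B A' B' : ℤ, 4 * A ^ 3 + 27 * B ^ 2 ≠ 0 → 4 * A' ^ 3 + 27 * B' ^ 2 ≠ 0 →
      (∃ (f g : ℚ[X]) (c : ℚ),
        C (c ^ 2) * g * (f ^ 3 + C (A' : ℚ) * f * g ^ 2 + C (B' : ℚ) * g ^ 3) =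
        (X ^ 3 + C (A : ℚ) * X + C (B : ℚ)) * (derivative f * g - f * derivative g) ^ 2) →
      ∀ (a b : ℚ), 0 < a → 0 < b → ∀ (r r' : KZ.IntegralRep 1),
        r.domain = {x | 0 < x 0 ^ 3 + (A : ℝ) * x 0 + (B : ℝ)} →
        EqOn r.integrand (fun x => (a : ℝ) / Real.sqrt (x 0 ^ 3 + (A : ℝ) * x 0 + (B : ℝ))) r.domain →
        r'.domain = {x | 0 < x 0 ^ 3 + (A' : ℝ) * x 0 + (B' : ℝ)} →
        EqOn r'.integrand (fun x => (b : ℝ) / Real.sqrt (x 0 ^ 3 + (A' : ℝ) * x 0 + (B' : ℝ))) r'.domain →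
        r.value = r'.value → KZ.Equivalent r r') ↔
    RealPeriodSectorComplete := by
  constructor
  · intro h A B A' B' hΔ hΔ'
    exact h A B A' B' hΔ hΔ' ⟨0, 0, 0, by simp⟩
  · intro h A B A' B' hΔ hΔ' _
    exact h A B A' B' hΔ hΔ'

/-- **The identity is load-bearing for the proof plan, not refutable**: with it deleted, `W ≠ 0` is
solved by `(f, g) = (X, 1)` for every pair, and the crux becomes crux #4 verbatim. [folklore] -/
theorem withoutIdentity_iff_sectorComplete :
    (∀ A B A' B' : ℤ, 4 * A ^ 3 + 27 * B ^ 2 ≠ 0 → 4 * A' ^ 3 + 27 * B' ^ 2 ≠ 0 →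
      (∃ (f g : ℚ[X]), derivative f * g - f * derivative g ≠ 0) →
      ∀ (a b : ℚ), 0 < a → 0 < b → ∀ (r r' : KZ.IntegralRep 1),
        r.domain = {x | 0 < x 0 ^ 3 + (A : ℝ) * x 0 + (B : ℝ)} →
        EqOn r.integrand (fun x => (a : ℝ) / Real.sqrt (x 0 ^ 3 + (A : ℝ) * x 0 + (B : ℝ))) r.domain →
        r'.domain = {x | 0 < x 0 ^ 3 + (A' : ℝ) * x 0 + (B' : ℝ)} →
        EqOn r'.integrand (fun x => (b : ℝ) / Real.sqrt (x 0 ^ 3 + (A' : ℝ) * x 0 + (B' : ℝ))) r'.domain →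
        r.value = r'.value → KZ.Equivalent r r') ↔
    RealPeriodSectorComplete := by
  constructor
  · intro h A B A' B' hΔ hΔ'
    exact h A B A' B' hΔ hΔ' ⟨X, 1, by simp⟩
  · intro h A B A' B' hΔ hΔ' _
    exact h A B A' B' hΔ hΔ'

/-! ### Degenerate data admitted by the typed shape (all genuine real coverings) -/

/-- The inversion datum `(X, 1, −1)` (`[−1]`): `c < 0` occurs. [folklore] -/
theorem datum_neg (A B : ℤ) :
    derivative (X : ℚ[X]) * 1 - X * derivative 1 ≠ 0 ∧
    C (((-1 : ℚ)) ^ 2) * (1 : ℚ[X]) * (X ^ 3 + C (A : ℚ) * X * 1 ^ 2 + C (B : ℚ) * 1 ^ 3) =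
      (X ^ 3 + C (A : ℚ) * X + C (B : ℚ)) * (derivative X * 1 - X * derivative 1) ^ 2 := by
  refine ⟨by simp, Polynomial.funext fun x => ?_⟩
  simp

/-- The scaling datum `(u²X, 1, u⁻¹)`, `u ∈ ℤ ∖ {0}`, onto `(u⁴A, u⁶B)`: `|c| ≠ 1` without kernel.
[folklore] -/
theorem datum_scale (A B u : ℤ) (hu : u ≠ 0) :
    derivative (C ((u : ℚ) ^ 2) * X) * (1 : ℚ[X]) - C ((u : ℚ) ^ 2) * X * derivative 1 ≠ 0 ∧
    C (((u : ℚ)⁻¹) ^ 2) * (1 : ℚ[X]) * ((C ((u : ℚ) ^ 2) * X) ^ 3 +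
        C ((u ^ 4 * A : ℤ) : ℚ) * (C ((u : ℚ) ^ 2) * X) * 1 ^ 2 + C ((u ^ 6 * B : ℤ) : ℚ) * 1 ^ 3) =
      (X ^ 3 + C (A : ℚ) * X + C (B : ℚ)) *
        (derivative (C ((u : ℚ) ^ 2) * X) * 1 - C ((u : ℚ) ^ 2) * X * derivative 1) ^ 2 := by
  have hu' : (u : ℚ) ≠ 0 := by exact_mod_cast hu
  have hW : derivative (C ((u : ℚ) ^ 2) * X) * (1 : ℚ[X]) - C ((u : ℚ) ^ 2) * X * derivative (1 : ℚ[X]) =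
      C ((u : ℚ) ^ 2) := by
    simp only [derivative_mul, derivative_C, zero_mul, derivative_X, mul_one, zero_add,
      derivative_one, mul_zero, sub_zero]
  refine ⟨?_, ?_⟩
  · rw [hW]; exact C_ne_zero.mpr (pow_ne_zero 2 hu')
  · rw [hW]
    refine Polynomial.funext fun x => ?_
    simp only [eval_mul, eval_C, eval_add, eval_pow, eval_X, Int.cast_mul, Int.cast_pow,
      one_pow, mul_one]
    field_simp

/-- The lemniscate 2-isogeny datum `(X² − 1, X, 1)`: `y² = x³ − x → y² = x³ + 4x`, real kernel
point `(0,0)`, two sheets onto `(0, ∞)` (`m₀ = 2`, `|c| = 1`). [cite: SilvermanAEC2009, Example III.4.5] -/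
theorem datum_lemniscate :
    derivative (X ^ 2 - 1 : ℚ[X]) * X - (X ^ 2 - 1) * derivative X ≠ 0 ∧
    C ((1 : ℚ) ^ 2) * (X : ℚ[X]) * ((X ^ 2 - 1) ^ 3 + C ((4 : ℤ) : ℚ) * (X ^ 2 - 1) * X ^ 2 +
        C ((0 : ℤ) : ℚ) * X ^ 3) =
      (X ^ 3 + C ((-1 : ℤ) : ℚ) * X + C ((0 : ℤ) : ℚ)) *
        (derivative (X ^ 2 - 1 : ℚ[X]) * X - (X ^ 2 - 1) * derivative X) ^ 2 := by
  have hW : derivative (X ^ 2 - 1 : ℚ[X]) * X - (X ^ 2 - 1) * derivative X = X ^ 2 + 1 := by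
    simp only [derivative_sub, derivative_X_pow, derivative_one, derivative_X, Nat.cast_ofNat,
      map_ofNat, Nat.add_one_sub_one, pow_one]
    ring
  refine ⟨?_, Polynomial.funext fun x => ?_⟩
  · rw [hW]; intro h0
    have := congrArg (fun p : ℚ[X] => p.eval 0) h0
    norm_num at this
  · rw [hW]; simp; ring

/-- The dual direction `y² = x³ + 4x → y² = x³ − x` (`φ̂ ∘ φ = [2]`, `c = 2`): datum
`(X² + 4, 4X, 2)`; `R = (x² + 4)/(4x)` maps `(0, ∞)` 2 : 1 onto `(1, ∞)`, the UNBOUNDED component of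
`{x³ − x > 0}` only — the egg `(−1, 0)` is not hit (`m₁ = 0`), so the egg′ ↔ unbounded′ Möbius step
of the proof plan is exercised by data in scope. [cite: SilvermanAEC2009, Example III.4.5] -/
theorem datum_lemniscate_dual :
    derivative (X ^ 2 + 4 : ℚ[X]) * (4 * X) - (X ^ 2 + 4) * derivative (4 * X) ≠ 0 ∧
    C ((2 : ℚ) ^ 2) * (4 * X : ℚ[X]) * ((X ^ 2 + 4) ^ 3 + C ((-1 : ℤ) : ℚ) * (X ^ 2 + 4) * (4 * X) ^ 2 +
        C ((0 : ℤ) : ℚ) * (4 * X) ^ 3) =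
      (X ^ 3 + C ((4 : ℤ) : ℚ) * X + C ((0 : ℤ) : ℚ)) *
        (derivative (X ^ 2 + 4 : ℚ[X]) * (4 * X) - (X ^ 2 + 4) * derivative (4 * X)) ^ 2 := by
  have hW : derivative (X ^ 2 + 4 : ℚ[X]) * (4 * X) - (X ^ 2 + 4) * derivative (4 * X) =
      4 * X ^ 2 - 16 := by
    simp only [derivative_add, derivative_X_pow, derivative_mul, derivative_X, Nat.cast_ofNat,
      map_ofNat, derivative_ofNat, Nat.add_one_sub_one, pow_one, zero_mul, zero_add, add_zero,
      mul_one]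
    ring
  refine ⟨?_, Polynomial.funext fun x => ?_⟩
  · rw [hW]; intro h0
    have := congrArg (fun p : ℚ[X] => p.eval 0) h0
    norm_num at this
  · rw [hW]; simp; ring

end Summit.KontsevichZagierPeriods.IsogenyCertificates.XMapPeriodTransferDatum
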